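import Literature.NumberTheory.EllipticCurves.HasseWeilAbelianConductor
import Literature.NumberTheory.EllipticCurves.NeronOggShafarevich
import Literature.NumberTheory.EllipticCurves.TateModuleFixedPointsProofs
import HarnessLib

/-!
# The criterion of Néron–Ogg–Shafarevich: `V_ℓ` form, and from the tame conductor exponents (proofs)

`Proofs` companion (theorems only) of `Literature.NumberTheory.EllipticCurves.NeronOggShafarevich`.

**§1 (`V_ℓ` form).**  An element of `Γ_K` acts trivially on `T_ℓ E` iff it acts trivially on
`V_ℓ E = ℚ_ℓ ⊗ T_ℓ E` (`T_ℓ E ↪ V_ℓ E`, `Literature.NumberTheory.EllipticCurves.TateModule.toRational_injective`), so the criterion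
(Silverman, *AEC*, Thm. VII.7.1 (a) ⇔ (c)) reads equally for the rational Tate module — the form
in which Serre states it (*Abelian ℓ-adic representations*, IV.1.3: "`ρ_ℓ` is ramified at `v ∤ ℓ`
iff `E` has bad reduction at `v`"): application forms
`hasGoodReductionAt_of_forall_galoisRepTate_eq_one`,
`hasGoodReductionAt_of_isUnramifiedAt_tateGaloisRep`; then
`hasGoodReductionAt_iff_forall_rationalGaloisRepTate_eq_one`,
`hasGoodReductionAt_iff_isUnramifiedAt_rationalTateGaloisRep` (for the tree's
`Literature.NumberTheory.GaloisRepresentations.GaloisRep.IsUnramifiedAt`), `mem_badPlaces_iff_not_isUnramifiedAt` — all from the named fact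
`neronOggShafarevich W`.

**§2 (from *ATAEC* IV.10.2(a)).**  The named fact `WeierstrassCurve.neronOggShafarevich W`
(Silverman, *AEC*, Thm. VII.7.1 (c) ⇒ (a):
for `v ∤ ℓ`, if the inertia groups above `v` act trivially on `T_ℓ E` then `E` has good reduction
at `v`) is the qualitative shadow of Silverman, *ATAEC*, Thm. IV.10.2(a) — the tame conductor
exponent `ε_v = codim_{ℚ_ℓ} (V_ℓ E)^{I_𝔓}` is `0, 1, 2` according as the reduction at `v` is good,
multiplicative, additive — whose two bad cases the tree vendors as the named facts
`WeierstrassCurve.codimFixed_inertia_rationalTate_eq_one_of_hasMultiplicativeReductionAt W ℓ` and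
`WeierstrassCurve.codimFixed_inertia_rationalTate_eq_two_of_hasAdditiveReductionAt W ℓ`
(file `HasseWeilAbelianConductor`, trunk EllArithM item C15).  §2 proves the implication

* `WeierstrassCurve.neronOggShafarevich_of_codimFixed_facts`: IV.10.2(a) at the multiplicative and
  at the additive places (for every prime `ℓ`) ⇒ `neronOggShafarevich W`,

by the local trichotomy
(`hasGoodReductionAt_or_hasMultiplicativeReductionAt_or_hasAdditiveReductionAt`): if `I_𝔓` acts
trivially on `T_ℓ E` it acts trivially on `V_ℓ E = ℚ_ℓ ⊗ T_ℓ E`, so `codim (V_ℓ E)^{I_𝔓} = 0`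
(`ContinuousRep.codimFixed_eq_zero_of_forall_eq_one`), which excludes `ε_v = 1` and `ε_v = 2`.
(Continuity of the Galois action on `V_ℓ E`, needed to form the `Literature.NumberTheory.GaloisRepresentations.GaloisRep`, is the tree's
`continuous_rationalGaloisRepTate_holds`.)  Consequently the consumers of the criterion in
`NeronOggShafarevich` — Cor. VII.7.2 (`IsIsogenous.badPlaces_eq_of_neronOggShafarevich`) and
Cor. IX.6.2 from Shafarevich's theorem —
also follow from the C15 facts: `IsIsogenous.badPlaces_eq_of_codimFixed_facts`,
`exists_finset_variableChange_of_isIsogenous_of_shafarevich_of_codimFixed_facts`.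

## References

* [SilvermanATAEC1994] J. H. Silverman, *Advanced Topics in the Arithmetic of Elliptic Curves*,
  GTM 151 (1994), §IV.10, Thm. 10.2(a) (PDF p. 358).
* [SilvermanAEC2009] J. H. Silverman, *The Arithmetic of Elliptic Curves*, 2nd ed. (2009),
  Thm. VII.7.1, Cor. VII.7.2, Cor. IX.6.2.
* [SerreTate1968] J.-P. Serre, J. Tate, *Good reduction of abelian varieties*, Ann. of Math. 88
  (1968), §1 Thm. 1, §2.1.
* [SerreAbelianLadic1968] J.-P. Serre, *Abelian ℓ-adic representations and elliptic curves*
  (1968), Ch. I §2.1, Ch. IV §1.3.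
-/

noncomputable section

open scoped Classical
open NumberField IsDedekindDomain

universe u

namespace WeierstrassCurve

open Literature.NumberTheory.EllipticCurves Literature.NumberTheory.GaloisRepresentations Field IsDedekindDomain.HeightOneSpectrum

variable {K : Type u} [Field K] (W : WeierstrassCurve K)

/-- If an element `τ ∈ Γ_K` acts trivially on `T_ℓ E` then it acts trivially on
`V_ℓ E = ℚ_ℓ ⊗ T_ℓ E` (base change, `Module.End.baseChangeHom`). [folklore] -/
theorem rationalGaloisRepTate_eq_one_of_galoisRepTate_eq_one (ℓ : ℕ) [Fact ℓ.Prime]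
    {τ : absoluteGaloisGroup K} (h : W.galoisRepTate ℓ τ = 1) :
    W.rationalGaloisRepTate ℓ τ = 1 := by
  change Module.End.baseChangeHom ℤ_[ℓ] ℚ_[ℓ] (W.tateModule ℓ) (W.galoisRepTate ℓ τ) = 1
  rw [h, map_one]

/-- Conversely, if `τ ∈ Γ_K` acts trivially on `V_ℓ E` then it acts trivially on `T_ℓ E`, because
`T_ℓ E → V_ℓ E`, `x ↦ 1 ⊗ x`, is injective (`T_ℓ E` is torsion-free;
`Literature.NumberTheory.EllipticCurves.TateModule.toRational_injective`). [folklore] -/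
theorem galoisRepTate_eq_one_of_rationalGaloisRepTate_eq_one (ℓ : ℕ) [Fact ℓ.Prime]
    {τ : absoluteGaloisGroup K} (h : W.rationalGaloisRepTate ℓ τ = 1) :
    W.galoisRepTate ℓ τ = 1 := by
  refine LinearMap.ext fun x ↦ TateModule.toRational_injective (A := geomPoints W) (p := ℓ) ?_
  rw [galoisRepTate_apply_apply, Module.End.one_apply]
  have hx := LinearMap.congr_fun h (TateModule.toRational ℓ x)
  rwa [Module.End.one_apply] at hx

/-- `τ ∈ Γ_K` acts trivially on `T_ℓ E` iff it acts trivially on `V_ℓ E`. [folklore] -/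
theorem galoisRepTate_eq_one_iff_rationalGaloisRepTate_eq_one (ℓ : ℕ) [Fact ℓ.Prime]
    {τ : absoluteGaloisGroup K} : W.galoisRepTate ℓ τ = 1 ↔ W.rationalGaloisRepTate ℓ τ = 1 :=
  ⟨W.rationalGaloisRepTate_eq_one_of_galoisRepTate_eq_one ℓ,
    W.galoisRepTate_eq_one_of_rationalGaloisRepTate_eq_one ℓ⟩

/-! ## §1 The criterion, application forms -/

section Apply

variable [NumberField K] (ℓ : ℕ) [Fact ℓ.Prime]

/-- **The criterion of Néron–Ogg–Shafarevich, application form** (Silverman, *AEC*, Thm. VII.7.1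
(c) ⇒ (a)): granted the named fact `neronOggShafarevich W`, if `v ∤ ℓ` and every inertia group
above `v` acts trivially on `T_ℓ E`, then `E` has good reduction at `v`.  (Theorem-style name for
the named fact, as suggested in the review of `NeronOggShafarevich`.)
[cite: SilvermanAEC2009, Thm. VII.7.1 (c) ⇒ (a)] -/
theorem hasGoodReductionAt_of_forall_galoisRepTate_eq_one [W.IsElliptic]
    (hNOS : W.neronOggShafarevich) {v : HeightOneSpectrum (𝓞 K)} (hℓ : (ℓ : 𝓞 K) ∉ v.asIdeal)
    (hunr : ∀ ⦃𝔓 : Ideal (absIntegers (𝓞 K) K)⦄, 𝔓 ∈ v.primesAbove →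
      ∀ ⦃τ : absoluteGaloisGroup K⦄, τ ∈ 𝔓.inertia (absoluteGaloisGroup K) →
        W.galoisRepTate ℓ τ = 1) :
    W.HasGoodReductionAt v :=
  hNOS v ℓ hℓ hunr

/-- Application form with the tree's `GaloisRep.IsUnramifiedAt`: granted `neronOggShafarevich W`,
if `T_ℓ E` (as `W.tateGaloisRep ℓ h`) is unramified at `v ∤ ℓ` then `E` has good reduction at `v`.
[cite: SilvermanAEC2009, Thm. VII.7.1 (c) ⇒ (a)] -/
theorem hasGoodReductionAt_of_isUnramifiedAt_tateGaloisRep [W.IsElliptic]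
    (hNOS : W.neronOggShafarevich)
    (h : Continuous fun x : absoluteGaloisGroup K × W.tateModule ℓ ↦ W.galoisRepTate ℓ x.1 x.2)
    {v : HeightOneSpectrum (𝓞 K)} (hℓ : (ℓ : 𝓞 K) ∉ v.asIdeal)
    (hunr : (W.tateGaloisRep ℓ h).IsUnramifiedAt v) : W.HasGoodReductionAt v :=
  (W.hasGoodReductionAt_iff_isUnramifiedAt_tateGaloisRep ℓ hNOS h hℓ).mpr hunr

end Apply

/-! ## §1' The criterion for the rational Tate module `V_ℓ E` -/

section Rational

variable [NumberField K] (ℓ : ℕ) [Fact ℓ.Prime]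

/-- **Silverman, *AEC*, Thm. VII.7.1, (a) ⇔ (c), for `V_ℓ E`.**  For an elliptic curve `E/K` over a
number field, `v ∤ ℓ`: `E` has good reduction at `v` iff every inertia group `I_𝔓`, `𝔓 ∣ v`,
acts trivially on `V_ℓ E` — granted the named fact `neronOggShafarevich W` for (⇐).
[cite: SilvermanAEC2009, Thm. VII.7.1 (a) ⇔ (c)] -/
theorem hasGoodReductionAt_iff_forall_rationalGaloisRepTate_eq_one [W.IsElliptic]
    (hNOS : W.neronOggShafarevich) {v : HeightOneSpectrum (𝓞 K)} (hℓ : (ℓ : 𝓞 K) ∉ v.asIdeal) :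
    W.HasGoodReductionAt v ↔
      ∀ ⦃𝔓 : Ideal (absIntegers (𝓞 K) K)⦄, 𝔓 ∈ v.primesAbove →
        ∀ ⦃τ : absoluteGaloisGroup K⦄, τ ∈ 𝔓.inertia (absoluteGaloisGroup K) →
          W.rationalGaloisRepTate ℓ τ = 1 := by
  rw [W.hasGoodReductionAt_iff_forall_galoisRepTate_eq_one ℓ hNOS hℓ]
  simp only [W.galoisRepTate_eq_one_iff_rationalGaloisRepTate_eq_one ℓ]

/-- Thm. VII.7.1, (a) ⇔ (c), for the continuous Galois representation
`W.rationalTateGaloisRep ℓ h : Literature.GaloisRep K ℚ_[ℓ] (V_ℓ E)` and the tree's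
`GaloisRep.IsUnramifiedAt` — Serre's formulation (*Abelian ℓ-adic representations*, IV.1.3):
for `v ∤ ℓ`, `E` has good reduction at `v` iff `ρ_ℓ` is unramified at `v`.
[cite: SilvermanAEC2009, Thm. VII.7.1 (a) ⇔ (c)] -/
theorem hasGoodReductionAt_iff_isUnramifiedAt_rationalTateGaloisRep [W.IsElliptic]
    (hNOS : W.neronOggShafarevich)
    (h : Continuous fun x : absoluteGaloisGroup K × W.rationalTateModule ℓ ↦
      W.rationalGaloisRepTate ℓ x.1 x.2)
    {v : HeightOneSpectrum (𝓞 K)} (hℓ : (ℓ : 𝓞 K) ∉ v.asIdeal) :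
    W.HasGoodReductionAt v ↔ (W.rationalTateGaloisRep ℓ h).IsUnramifiedAt v :=
  ⟨fun hv ↦ W.isUnramifiedAt_rationalTateGaloisRep ℓ h hv hℓ, fun hunr ↦
    (W.hasGoodReductionAt_iff_forall_rationalGaloisRepTate_eq_one ℓ hNOS hℓ).mpr
      fun _ h𝔓 _ hτ ↦ hunr _ h𝔓 _ hτ⟩

/-- Thm. VII.7.1, (a) ⇔ (c), for `V_ℓ E`, with the continuity of the Galois action supplied by the
tree (`continuous_rationalGaloisRepTate_holds`). [cite: SilvermanAEC2009, Thm. VII.7.1 (a) ⇔ (c)] -/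
theorem hasGoodReductionAt_iff_isUnramifiedAt_rationalTateGaloisRep' [W.IsElliptic]
    (hNOS : W.neronOggShafarevich) {v : HeightOneSpectrum (𝓞 K)} (hℓ : (ℓ : 𝓞 K) ∉ v.asIdeal) :
    W.HasGoodReductionAt v ↔
      (W.rationalTateGaloisRep ℓ (W.continuous_rationalGaloisRepTate_holds ℓ)).IsUnramifiedAt v :=
  W.hasGoodReductionAt_iff_isUnramifiedAt_rationalTateGaloisRep ℓ hNOS _ hℓ

/-- **The bad places away from `ℓ` are exactly the places where `V_ℓ E` is ramified** (Serre,
*Abelian ℓ-adic representations*, IV.1.3; Silverman, *AEC*, Thm. VII.7.1): for `v ∤ ℓ`,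
`v ∈ badPlaces E ↔ ρ_ℓ` is ramified at `v` — granted `neronOggShafarevich W`.
[cite: SilvermanAEC2009, Thm. VII.7.1 (a) ⇔ (c)] -/
theorem mem_badPlaces_iff_not_isUnramifiedAt [W.IsElliptic] (hNOS : W.neronOggShafarevich)
    (h : Continuous fun x : absoluteGaloisGroup K × W.rationalTateModule ℓ ↦
      W.rationalGaloisRepTate ℓ x.1 x.2)
    {v : HeightOneSpectrum (𝓞 K)} (hℓ : (ℓ : 𝓞 K) ∉ v.asIdeal) :
    v ∈ W.badPlaces (𝓞 K) ↔ ¬ (W.rationalTateGaloisRep ℓ h).IsUnramifiedAt v :=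
  not_congr (W.hasGoodReductionAt_iff_isUnramifiedAt_rationalTateGaloisRep ℓ hNOS h hℓ)

end Rational

/-! ## §2 The criterion from *ATAEC* Thm. IV.10.2(a) at the bad places -/

variable [NumberField K]

/-- **Thm. VII.7.1 (c) ⇒ (a) from *ATAEC* Thm. IV.10.2(a) at the bad places.**  For a Weierstrass
curve `W` over a number field `K`: if, for every prime `ℓ`, the codimension
of the inertia invariants of `V_ℓ E` is `1` at the multiplicative places `v ∤ ℓ` (`hTm`) and `2` at
the additive places `v ∤ ℓ` (`hTa`) — the named facts of `HasseWeilAbelianConductor` — then the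
criterion of Néron–Ogg–Shafarevich `neronOggShafarevich W` holds: an inertia group acting
trivially on `T_ℓ E` acts trivially on `V_ℓ E`, so the codimension is `0`, and by the local
trichotomy the reduction at `v` is good. [cite: SilvermanATAEC1994, Thm. IV.10.2(a) (PDF p. 358)]
[cite: SilvermanAEC2009, Thm. VII.7.1 (c) ⇒ (a)] -/
theorem neronOggShafarevich_of_codimFixed_facts
    (hTm : ∀ (ℓ : ℕ) [Fact ℓ.Prime],
      W.codimFixed_inertia_rationalTate_eq_one_of_hasMultiplicativeReductionAt ℓ)
    (hTa : ∀ (ℓ : ℕ) [Fact ℓ.Prime],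
      W.codimFixed_inertia_rationalTate_eq_two_of_hasAdditiveReductionAt ℓ) :
    W.neronOggShafarevich := by
  intro _ _ v ℓ _ hℓ hunr
  obtain ⟨𝔓, h𝔓⟩ := v.primesAbove_nonempty
  have hc := W.continuous_rationalGaloisRepTate_holds ℓ
  have h0 : (rationalTateGaloisRepOf (geomPoints W) ℓ hc).codimFixed
      (𝔓.inertia (absoluteGaloisGroup K)) = 0 :=
    ContinuousRep.codimFixed_eq_zero_of_forall_eq_one _ fun τ hτ ↦
      W.rationalGaloisRepTate_eq_one_of_galoisRepTate_eq_one ℓ (hunr h𝔓 hτ)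
  rcases W.hasGoodReductionAt_or_hasMultiplicativeReductionAt_or_hasAdditiveReductionAt v with
    hv | hv | hv
  · exact hv
  · exact absurd ((hTm ℓ hc v hℓ hv h𝔓).symm.trans h0) one_ne_zero
  · exact absurd ((hTa ℓ hc v hℓ hv h𝔓).symm.trans h0) two_ne_zero

variable {W} {W' : WeierstrassCurve K}

/-- **Cor. VII.7.2 from the C15 facts.**  `K`-isogenous elliptic curves over a number field have
the same places of bad reduction (the statement of the named fact `IsIsogenous.badPlaces_eq W W'`
of `ShafarevichGoodReduction`), granted *ATAEC* IV.10.2(a) at the multiplicative and additive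
places for `W` and for `W'`. [cite: SilvermanAEC2009, Cor. VII.7.2]
[cite: SilvermanATAEC1994, Thm. IV.10.2(a) (PDF p. 358)] -/
theorem IsIsogenous.badPlaces_eq_of_codimFixed_facts [W.IsElliptic] [W'.IsElliptic]
    (h : IsIsogenous W W')
    (hTm : ∀ (ℓ : ℕ) [Fact ℓ.Prime],
      W.codimFixed_inertia_rationalTate_eq_one_of_hasMultiplicativeReductionAt ℓ)
    (hTa : ∀ (ℓ : ℕ) [Fact ℓ.Prime],
      W.codimFixed_inertia_rationalTate_eq_two_of_hasAdditiveReductionAt ℓ)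
    (hTm' : ∀ (ℓ : ℕ) [Fact ℓ.Prime],
      W'.codimFixed_inertia_rationalTate_eq_one_of_hasMultiplicativeReductionAt ℓ)
    (hTa' : ∀ (ℓ : ℕ) [Fact ℓ.Prime],
      W'.codimFixed_inertia_rationalTate_eq_two_of_hasAdditiveReductionAt ℓ) :
    W.badPlaces (𝓞 K) = W'.badPlaces (𝓞 K) :=
  h.badPlaces_eq_of_neronOggShafarevich' (W.neronOggShafarevich_of_codimFixed_facts hTm hTa)
    (W'.neronOggShafarevich_of_codimFixed_facts hTm' hTa')

variable (W)

/-- **Cor. IX.6.2 from Shafarevich's theorem and the C15 facts.**  For an elliptic curve `E` over a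
number field `K`: granted Shafarevich's theorem IX.6.1 for `K` (`hSha`) and *ATAEC* IV.10.2(a) at
the multiplicative and additive places of every Weierstrass curve over `K` (`hTm`, `hTa`), the
elliptic curves `K`-isogenous to `E` fall into finitely many `K`-isomorphism classes (the body of
the named fact `finite_isogenyClass W`, file `IsogenyClassFinite`).
[cite: SilvermanAEC2009, Cor. IX.6.2 (proof)]
[cite: SilvermanATAEC1994, Thm. IV.10.2(a) (PDF p. 358)] -/
theorem exists_finset_variableChange_of_isIsogenous_of_shafarevich_of_codimFixed_facts
    [W.IsElliptic] (hSha : shafarevich_finite_goodReductionOutside K)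
    (hTm : ∀ (W' : WeierstrassCurve K) (ℓ : ℕ) [Fact ℓ.Prime],
      W'.codimFixed_inertia_rationalTate_eq_one_of_hasMultiplicativeReductionAt ℓ)
    (hTa : ∀ (W' : WeierstrassCurve K) (ℓ : ℕ) [Fact ℓ.Prime],
      W'.codimFixed_inertia_rationalTate_eq_two_of_hasAdditiveReductionAt ℓ) :
    ∃ F : Finset (WeierstrassCurve K), ∀ (W' : WeierstrassCurve K) [W'.IsElliptic],
      IsIsogenous W W' → ∃ C : VariableChange K, C • W' ∈ F :=
  W.exists_finset_variableChange_of_isIsogenous_of_shafarevich_of_neronOggShafarevich hSha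
    fun W' ↦ W'.neronOggShafarevich_of_codimFixed_facts (hTm W') (hTa W')

end WeierstrassCurve

end
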